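import Summits.MatrixMultiplication.OmegaCensus.STPPVosperSlackFourCell22MaskSets
import Summits.MatrixMultiplication.OmegaCensus.STPPVosperSlackFourCell22Sound
import Summits.MatrixMultiplication.OmegaCensus.STPPVosperSlackFourCell22Certs
import Summits.MatrixMultiplication.OmegaCensus.STPPZoo313Theorem

/-!
# ω-census (abelian STPP census): cell (2,2) of the slack-4 law — REDUCTION to the normal form and the cell theorem (fifth ℤ₆₁ leaf)

HONEST FRAMING (pub-omega census; verbatim): lottery ticket; floor = certified bounds/negative ranges.
Census STRUCTURE (seat pub-omega-stpp-2 gen 28, 2026-08-29), family (b2).  `c22_false_of_rows`: the hypothesis `h22` of stpp-1 g33's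
`no_isSTPP_of_slack_four_tables_of_cell22` (`STPPVosperSlackFourLawT.lean`) for a `(3,3,3)` block `i` with `Σ_{k≠i}|A_k||C_k| = Σ_{k≠i}|B_k||C_k| = 13`
in `ℤ/61` — `#SY = 17 → #T = 17 → False` — GIVEN (a) the cell-(2,2) rows `c22CheckS …` over `u ∈ [1,60]`, `y₀, y₀′ ∈ {2,3,4}`, `S ∈ c22Sh y₀`
(`STPPVosperSlackFourCell22RowsAsm.lean`), (b) a `CoverDead` table, and (c) the root row `zooGo 61 zooTbl61 12 59 3 0 1 [0] = true` of stpp-1 g33's zoo checker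
(`zoo313_61_of_rows`, `STPPZoo313Theorem.lean`; assembled from their zoo rows).  Steps: the zoo applied SET-LEVEL to affine copies of `(−Aᵢ, Y°)` and
`(−Bᵢ, Z°)` (`zoo_apply`: base-point choice `exists_base_of_card_three`, translation normal form `exists_shift_normal`); the class maps and shape table
(`STPPVosperSlackFourCell22Certs.lean`); ONE transport of the family (`isSTPP_dilate` + `IsSTPP.translate_shiftBC`, as in `caseGDeadT_false_of_HR`) to the
normal form of `c22_false_of_normal_form` (`STPPVosperSlackFourCell22Sound.lean`).  UNCONDITIONAL given (a)–(c); no `decide`.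
Nothing here is progress on `ω`.

References: H. Cohn, R. Kleinberg, B. Szegedy, C. Umans, FOCS 2005 (arXiv:math/0511460), Def. 5.1.
-/

open Finset
open scoped Pointwise

namespace Summit.MatrixMultiplication.OmegaCensus.CubeNB.S2

open Literature.Computability.AlgebraicComplexity
open Literature.Combinatorics.Additive
open Summit.MatrixMultiplication.OmegaCensus.STPPKneser
open Summit.MatrixMultiplication.OmegaCensus.CubeNB.Bits

/-! ## §1 Affine images of sumsets; base points; translation normal form -/

/-- Affine images add: `(λ·U + a) + (λ·V + b) = λ·(U + V) + (a + b)`. [folklore] -/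
theorem image_add_image_affine {p : ℕ} (U V : Finset (ZMod p)) (l a b : ZMod p) :
    U.image (fun v => l * v + a) + V.image (fun v => l * v + b) = (U + V).image fun v => l * v + (a + b) := by
  ext w
  simp only [Finset.mem_add, mem_image]
  constructor
  · rintro ⟨x, ⟨u', hu', rfl⟩, z, ⟨v', hv', rfl⟩, rfl⟩
    exact ⟨u' + v', ⟨u', hu', v', hv', rfl⟩, by ring⟩
  · rintro ⟨s, ⟨u', hu', v', hv', rfl⟩, rfl⟩
    exact ⟨l * u' + a, ⟨u', hu', rfl⟩, l * v' + b, ⟨v', hv', rfl⟩, by ring⟩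

/-- An affine map with unit slope is injective. [folklore] -/
theorem affine_injective' {p : ℕ} [Fact p.Prime] {l : ZMod p} (hl : l ≠ 0) (a : ZMod p) :
    Function.Injective fun v : ZMod p => l * v + a := fun _ _ h => mul_left_cancel₀ hl (add_right_cancel h)

/-- `60 = −1` in `ZMod 61`. [folklore] -/
theorem zmod61_cast60 : ((60 : ℕ) : ZMod 61) = -1 := by decide

/-- `(2 : ZMod 61).val = 2`. [folklore] -/
theorem zmod61_val_two : (2 : ZMod 61).val = 2 := by decide

/-- **Base point of a 3-set.**  Every 3-subset of `ZMod 61` is `x₀ + m·{0, 1, y}` with `m ≠ 0` and `2 ≤ y ≤ 59` (if the ratio is `−1`, re-base at the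
middle point, ratio `2`). [folklore] -/
theorem exists_base_of_card_three {X : Finset (ZMod 61)} (hX : #X = 3) :
    ∃ x₀ m y : ZMod 61, m ≠ 0 ∧ 2 ≤ y.val ∧ y.val ≤ 59 ∧ X = ({0, 1, y} : Finset (ZMod 61)).image fun v => m * v + x₀ := by
  haveI : Fact (Nat.Prime 61) := ⟨by norm_num⟩
  obtain ⟨a, b, c, hab, hac, hbc, rfl⟩ := card_eq_three.1 hX
  have hba : b - a ≠ 0 := sub_ne_zero.2 (Ne.symm hab)
  set y := (c - a) * (b - a)⁻¹ with hydef
  have hcy : c - a = y * (b - a) := by rw [hydef, inv_mul_cancel_right₀ hba]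
  by_cases hy : y = -1
  · refine ⟨b, a - b, 2, sub_ne_zero.2 hab, by rw [zmod61_val_two], by rw [zmod61_val_two]; norm_num, ?_⟩
    rw [hy] at hcy
    have hc : c = (a - b) * 2 + b := by linear_combination hcy
    rw [image_insert, image_insert, image_singleton, mul_zero, zero_add, mul_one, sub_add_cancel, ← hc]
    ext v; simp only [mem_insert, mem_singleton]; tauto
  · have hy0 : y ≠ 0 := by
      intro h0; rw [h0, zero_mul, sub_eq_zero] at hcy; exact hac hcy.symm
    have hy1 : y ≠ 1 := by
      intro h1; rw [h1, one_mul] at hcy; exact hbc (by linear_combination (-1 : ZMod 61) * hcy)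
    refine ⟨a, b - a, y, hba, ?_, ?_, ?_⟩
    · by_contra hlt
      have hv : y.val = 0 ∨ y.val = 1 := by omega
      rcases hv with hv | hv
      · exact hy0 ((ZMod.val_eq_zero y).1 hv)
      · exact hy1 (by
          have : y = ((y.val : ℕ) : ZMod 61) := (ZMod.natCast_zmod_val y).symm
          rw [this, hv]; rfl)
    · by_contra hlt
      have hv : y.val = 60 := by have := y.val_lt; omega
      apply hy
      have : y = ((y.val : ℕ) : ZMod 61) := (ZMod.natCast_zmod_val y).symm
      rw [this, hv, zmod61_cast60]
    · have hc : c = (b - a) * y + a := by linear_combination hcy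
      rw [image_insert, image_insert, image_singleton, mul_zero, zero_add, mul_one, sub_add_cancel, ← hc]

/-- **Translation normal form**: a non-empty proper subset of `ZMod 61` has a translate containing `0` and not `60 = −1` (a run starts at `0`).
[folklore] -/
theorem exists_shift_normal {Y : Finset (ZMod 61)} (h0 : Y.Nonempty) (h1 : Y ≠ univ) :
    ∃ τ : ZMod 61, (0 : ZMod 61) ∈ Y.image (· + τ) ∧ (60 : ZMod 61) ∉ Y.image (· + τ) := by
  have h61 : (61 : ZMod 61) = 0 := by decide
  by_contra hcon
  push Not at hcon
  have hstep : ∀ b ∈ Y, b - 1 ∈ Y := by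
    intro b hb
    have h := hcon (-b) (mem_image.2 ⟨b, hb, by ring⟩)
    obtain ⟨w, hw, hwb⟩ := mem_image.1 h
    have : w = b - 1 := by linear_combination hwb + h61
    rwa [this] at hw
  have hall : ∀ n : ℕ, ∀ b ∈ Y, b - (n : ZMod 61) ∈ Y := by
    intro n
    induction n with
    | zero => intro b hb; simpa using hb
    | succ n ih => intro b hb; have := hstep _ (ih b hb); push_cast; convert this using 1; ring
  obtain ⟨b, hb⟩ := h0
  apply h1
  ext v
  simp only [mem_univ, iff_true]
  have := hall (b - v).val b hb
  rwa [ZMod.natCast_zmod_val, sub_sub_cancel] at this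

/-! ## §2 Set-level application of the zoo -/

/-- **Set-level application of the zoo** to any pair `(X, Y)` with `#X = 3`, `#Y = 13`, `#(X + Y) = 17`: `X = x₀ + m·{0,1,y}` and
`Y = m·⟦B⟧ + τ` for a zoo pair `(y, B)` — given the root row of the zoo checker (`zoo313_61_of_rows`, stpp-1 g33). [cite: CohnKleinbergSzegedyUmans2005, Def. 5.1] -/
theorem zoo_apply (hzr : zooGo 61 zooTbl61 12 59 3 0 1 [0] = true) {X Y : Finset (ZMod 61)} (hX : #X = 3) (hY : #Y = 13) (hXY : #(X + Y) = 17) :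
    ∃ (x₀ m τ : ZMod 61) (y Bm : ℕ), m ≠ 0 ∧ (y, Bm) ∈ zooTbl61 ∧ X = ({0, 1, ((y : ℕ) : ZMod 61)} : Finset (ZMod 61)).image (fun v => m * v + x₀) ∧
      Y = (setOfMask 61 Bm).image (fun w => m * w + τ) ∧ Bm < 2 ^ 61 := by
  haveI : Fact (Nat.Prime 61) := ⟨by norm_num⟩
  obtain ⟨x₀, m, y', hm, hy2, hy59, hXeq⟩ := exists_base_of_card_three hX
  have hmi : m⁻¹ ≠ 0 := inv_ne_zero hm
  set Y₁ := Y.image (fun w => m⁻¹ * w + 0) with hY₁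
  have hY₁card : #Y₁ = 13 := by rw [hY₁, card_image_of_injective _ (affine_injective' hmi 0), hY]
  have hY₁ne : Y₁.Nonempty := card_pos.1 (by rw [hY₁card]; norm_num)
  have hY₁nu : Y₁ ≠ univ := fun h => by
    have := congrArg Finset.card h; rw [hY₁card, card_univ, ZMod.card] at this; omega
  obtain ⟨τ₁, h0, h60⟩ := exists_shift_normal hY₁ne hY₁nu
  set Y₂ := Y₁.image (· + τ₁) with hY₂
  have hY₂card : #Y₂ = 13 := by rw [hY₂, card_image_of_injective _ (add_left_injective τ₁), hY₁card]
  have hY₂eq : Y₂ = Y.image (fun w => m⁻¹ * w + τ₁) := by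
    rw [hY₂, hY₁, image_image]; exact image_congr fun w _ => by simp only [Function.comp_apply, add_zero]
  have hXinv : ({0, 1, y'} : Finset (ZMod 61)) = X.image (fun v => m⁻¹ * v + (-(m⁻¹ * x₀))) := by
    rw [hXeq, image_image]
    have : ((fun v => m⁻¹ * v + -(m⁻¹ * x₀)) ∘ fun v => m * v + x₀) = id := by
      funext v; simp only [Function.comp_apply, id]; rw [mul_add, ← mul_assoc, inv_mul_cancel₀ hm]; ring
    rw [this, image_id]
  have h17 : #(({0, 1, y'} : Finset (ZMod 61)) + Y₂) = 17 := by
    rw [hXinv, hY₂eq, image_add_image_affine, card_image_of_injective _ (affine_injective' hmi _), hXY]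
  have hmem := zoo313_61_of_rows hzr Y₂ y' hY₂card h0 h60 hy2 hy59 h17
  refine ⟨x₀, m, -(m * τ₁), y'.val, maskOf ((Y₂.image ZMod.val).sort (· ≤ ·)), hm, hmem, ?_, ?_, ?_⟩
  · rw [ZMod.natCast_zmod_val]; exact hXeq
  · rw [setOfMask_maskOf_sort, hY₂eq, image_image]
    have : ((fun w => m * w + -(m * τ₁)) ∘ fun w => m⁻¹ * w + τ₁) = id := by
      funext w; simp only [Function.comp_apply, id]; rw [mul_add, ← mul_assoc, mul_inv_cancel₀ hm]; ring
    rw [this, image_id]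
  · exact maskOf_lt_two_pow fun v hv => (valList_spec Y₂).2.2.1 v hv

/-- `(−1 : ZMod 61).val = 60`. [folklore] -/
theorem zmod61_val_neg_one : (-1 : ZMod 61).val = 60 := by decide

/-! ## §3 The cell theorem from its rows -/

/-- **THE STRUCTURE-FREE CELL (2,2) IS EMPTY, given its kernel rows, a dead table and the zoo's root row.**  For a block `i` with
`|Aᵢ| = |Bᵢ| = |Cᵢ| = 3`, `Σ_{k≠i}|A_k||C_k| = Σ_{k≠i}|B_k||C_k| = 13` of an STPP family of `ℤ/61` (non-empty blocks): `#SY = 17` and `#T = 17` are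
contradictory.  This is the hypothesis `h22` of `no_isSTPP_of_slack_four_tables_of_cell22`. [cite: CohnKleinbergSzegedyUmans2005, Def. 5.1] -/
theorem c22_false_of_rows [hfact : Fact (Nat.Prime 61)] (hzr : zooGo 61 zooTbl61 12 59 3 0 1 [0] = true) {tbl : List (List ℕ × List ℕ)}
    (hrows : ∀ u ∈ List.range' 1 60, ∀ y₀ ∈ [2, 3, 4], ∀ y₀' ∈ [2, 3, 4], ∀ S ∈ c22Sh y₀,
      c22CheckS 61 u (c22P 61 y₀) (c22Q 61 u y₀') S (c22TShapes 61 u (c22Sh y₀')) tbl = true)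
    {N : ℕ} {A B C : Fin N → Finset (ZMod 61)} (hS : IsSTPP A B C)
    (hA : ∀ k, (A k).Nonempty) (hB : ∀ k, (B k).Nonempty) (hC : ∀ k, (C k).Nonempty) (i : Fin N)
    (ha : #(A i) = 3) (hb : #(B i) = 3) (hc : #(C i) = 3)
    (hz : ∑ k ∈ univ.erase i, #(A k) * #(C k) = 13) (hL : ∑ k ∈ univ.erase i, #(B k) * #(C k) = 13)
    (ks : List (Fin N)) (hks : ks.Nodup) (hksi : ∀ k, k ∈ ks ↔ k ≠ i) {szs : List (ℕ × ℕ × ℕ)}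
    (hszs : ks.map (fun k => (#(A k), #(B k), #(C k))) = szs)
    (hdead : ∀ e ∈ tbl, CoverDead 61 N i szs e.1 e.2)
    (hSY : #((A i).image (fun x => (0 : ZMod 61) - x) + DU B C (univ.erase i)) = 17)
    (hT : #((B i).image (fun x => (0 : ZMod 61) - x) + DU A C (univ.erase i)) = 17) : False := by
  have hYcard : #(DU B C (univ.erase i)) = 13 := by rw [card_DU_BC hS hA, hL]
  have hZcard : #(DU A C (univ.erase i)) = 13 := by rw [card_DU_AC hS hB, hz]
  have hXcard : #((A i).image fun x => (0 : ZMod 61) - x) = 3 := by rw [card_image_of_injective _ sub_right_injective, ha]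
  have hXBcard : #((B i).image fun x => (0 : ZMod 61) - x) = 3 := by rw [card_image_of_injective _ sub_right_injective, hb]
  -- the zoo on both pairs
  obtain ⟨x₀, m, τA, y, Bm, hm, hmemA, hXeq, hYeq, hBm⟩ := zoo_apply hzr hXcard hYcard hSY
  obtain ⟨x₀', m', τB, y', Bm', hm', hmemB, hXBeq, hZeq, hBm'⟩ := zoo_apply hzr hXBcard hZcard hT
  -- class data and shapes
  have hokA := c22ZooOK_all _ hmemA
  have hokB := c22ZooOK_all _ hmemB
  unfold c22ZooOK at hokA hokB
  rw [Bool.and_eq_true] at hokA hokB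
  have hkeyA : y ∈ c22Keys := List.mem_of_elem_eq_true hokA.1
  have hkeyB : y' ∈ c22Keys := List.mem_of_elem_eq_true hokB.1
  obtain ⟨hy₀, hμ0, hcls⟩ := c22Cls_spec y hkeyA
  obtain ⟨hy₀', hμ0', hcls'⟩ := c22Cls_spec y' hkeyB
  obtain ⟨-, hshA⟩ := hokA
  obtain ⟨-, hshB⟩ := hokB
  generalize hy₀g : (c22Cls y).1 = y₀ at hy₀ hcls hshA
  generalize hμg : (c22Cls y).2.1 = μn at hμ0 hcls hshA
  generalize hcg : (c22Cls y).2.2 = cn at hcls hshA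
  generalize hy₀g' : (c22Cls y').1 = y₀' at hy₀' hcls' hshB
  generalize hμg' : (c22Cls y').2.1 = μn' at hμ0' hcls' hshB
  generalize hcg' : (c22Cls y').2.2 = cn' at hcls' hshB
  set R := affMask 61 μn cn (sumMask 61 [0, 1, y] Bm) with hR
  set R' := affMask 61 μn' cn' (sumMask 61 [0, 1, y'] Bm') with hR'
  set S := normMask 61 R with hSdef
  set S' := normMask 61 R' with hS'def
  have hSmem : S ∈ c22Sh y₀ := List.mem_of_elem_eq_true hshA
  have hS'mem : S' ∈ c22Sh y₀' := List.mem_of_elem_eq_true hshB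
  obtain ⟨hSlt, -, -⟩ := c22Sh_runs y₀ hy₀ S hSmem
  obtain ⟨hS'lt, hS'rt, hS'runs⟩ := c22Sh_runs y₀' hy₀' S' hS'mem
  have hy₀bd : 2 ≤ y₀ ∧ y₀ ≤ 4 := by simp only [List.mem_cons, List.not_mem_nil, or_false] at hy₀; omega
  have hy₀'bd : 2 ≤ y₀' ∧ y₀' ≤ 4 := by simp only [List.mem_cons, List.not_mem_nil, or_false] at hy₀'; omega
  have hylt : y < 61 := by simp only [c22Keys, List.mem_cons, List.not_mem_nil, or_false] at hkeyA; omega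
  have hy'lt : y' < 61 := by simp only [c22Keys, List.mem_cons, List.not_mem_nil, or_false] at hkeyB; omega
  -- units and shifts
  set μ : ZMod 61 := (μn : ZMod 61) with hμ
  set c : ZMod 61 := (cn : ZMod 61) with hcdef
  set μ' : ZMod 61 := (μn' : ZMod 61) with hμ'
  set c' : ZMod 61 := (cn' : ZMod 61) with hc'def
  set lam : ZMod 61 := μ * m⁻¹ with hlam
  have hlam0 : lam ≠ 0 := mul_ne_zero hμ0 (inv_ne_zero hm)
  have hlamm : lam * m = μ := by rw [hlam, mul_assoc, inv_mul_cancel₀ hm, mul_one]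
  set uZ : ZMod 61 := lam * m' * μ'⁻¹ with huZ
  have huZ0 : uZ ≠ 0 := mul_ne_zero (mul_ne_zero hlam0 hm') (inv_ne_zero hμ0')
  have huZμ : uZ * μ' = lam * m' := by rw [huZ, mul_assoc, inv_mul_cancel₀ hμ0', mul_one]
  have hucast : ((uZ.val : ℕ) : ZMod 61) = uZ := ZMod.natCast_zmod_val uZ
  have hu1 : 1 ≤ uZ.val := by
    rw [Nat.one_le_iff_ne_zero]; exact fun h => huZ0 ((ZMod.val_eq_zero uZ).1 h)
  have hu61 : uZ.val < 61 := uZ.val_lt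
  generalize hudef : uZ.val = u at hucast hu1 hu61
  set t₀ : ZMod 61 := ((normRot 61 R : ℕ) : ZMod 61) with ht₀
  set t₀' : ZMod 61 := ((normRot 61 R' : ℕ) : ZMod 61) with ht₀'
  set g : ZMod 61 := lam * x₀ - c with hg
  set β : ZMod 61 := lam * x₀' - g - uZ * c' with hβ
  set δ : ZMod 61 := c + t₀ - lam * (x₀ + τA) with hδ
  set γ : ZMod 61 := δ + β + g with hγ
  set σ : ZMod 61 := lam * (x₀' + τB) + δ - uZ * (c' + t₀') with hσ
  have hscast : ((σ.val : ℕ) : ZMod 61) = σ := ZMod.natCast_zmod_val σ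
  have hs61 : σ.val < 61 := σ.val_lt
  generalize hsdef : σ.val = s at hscast hs61
  -- the transported family
  set t : Fin N → ZMod 61 := fun k => if k = i then g else 0 with ht
  have hti : t i = g := by simp [ht]
  have hS2 : IsSTPP (fun k => (A k).image (lam * ·)) (fun k => (B k).image (lam * ·)) (fun k => (C k).image (lam * ·)) :=
    isSTPP_dilate hS hlam0
  have hS3 := IsSTPP.translate_shiftBC hS2 t β γ
  set A3 : Fin N → Finset (ZMod 61) := fun k => ((A k).image (lam * ·)).image (· + t k) with hA3
  set B3 : Fin N → Finset (ZMod 61) := fun k => (((B k).image (lam * ·)).image (· + t k)).image (· + β) with hB3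
  set C3 : Fin N → Finset (ZMod 61) := fun k => (((C k).image (lam * ·)).image (· + t k)).image (· + γ) with hC3
  have hS3' : IsSTPP A3 B3 C3 := hS3
  have hmemA3 : ∀ k x, x ∈ A3 k ↔ ∃ v ∈ A k, lam * v + t k = x := by
    intro k x; simp only [hA3, mem_image, exists_exists_and_eq_and]
  have hmemB3 : ∀ k x, x ∈ B3 k ↔ ∃ v ∈ B k, lam * v + (t k + β) = x := by
    intro k x; simp only [hB3, mem_image, exists_exists_and_eq_and, add_assoc]
  have hmemC3 : ∀ k x, x ∈ C3 k ↔ ∃ v ∈ C k, lam * v + (t k + γ) = x := by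
    intro k x; simp only [hC3, mem_image, exists_exists_and_eq_and, add_assoc]
  have hA3eq : ∀ k, A3 k = (A k).image fun v => lam * v + t k := fun k => by ext x; rw [hmemA3, mem_image]
  have hB3eq : ∀ k, B3 k = (B k).image fun v => lam * v + (t k + β) := fun k => by ext x; rw [hmemB3, mem_image]
  have hC3eq : ∀ k, C3 k = (C k).image fun v => lam * v + (t k + γ) := fun k => by ext x; rw [hmemC3, mem_image]
  have hA3ne : ∀ k, (A3 k).Nonempty := fun k => by rw [hA3eq]; exact (hA _).image _
  have hB3ne : ∀ k, (B3 k).Nonempty := fun k => by rw [hB3eq]; exact (hB _).image _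
  have hC3ne : ∀ k, (C3 k).Nonempty := fun k => by rw [hC3eq]; exact (hC _).image _
  have hcardA : ∀ k, #(A3 k) = #(A k) := fun k => by rw [hA3eq, card_image_of_injective _ (affine_injective' hlam0 _)]
  have hcardB : ∀ k, #(B3 k) = #(B k) := fun k => by rw [hB3eq, card_image_of_injective _ (affine_injective' hlam0 _)]
  have hcardC : ∀ k, #(C3 k) = #(C k) := fun k => by rw [hC3eq, card_image_of_injective _ (affine_injective' hlam0 _)]
  have hc3 : #(C3 i) = 3 := by rw [hcardC, hc]
  have hz3 : ∑ k ∈ univ.erase i, #(A3 k) * #(C3 k) = 13 := by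
    rw [← hz]; exact Finset.sum_congr rfl fun k _ => by rw [hcardA, hcardC]
  have hL3 : ∑ k ∈ univ.erase i, #(B3 k) * #(C3 k) = 13 := by
    rw [← hL]; exact Finset.sum_congr rfl fun k _ => by rw [hcardB, hcardC]
  have hszs3 : ks.map (fun k => (#(A3 k), #(B3 k), #(C3 k))) = szs := by
    rw [← hszs]; exact List.map_congr_left fun k _ => by rw [hcardA, hcardB, hcardC]
  -- `A3 i = −{0,1,y₀}` and `B3 i = −uZ·{0,1,y₀′}`
  have hAi : A i = (({0, 1, ((y : ℕ) : ZMod 61)} : Finset (ZMod 61))).image fun v => -(m * v + x₀) := by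
    have h : A i = ((A i).image fun x => (0 : ZMod 61) - x).image fun x => (0 : ZMod 61) - x := by
      rw [image_image]; exact (image_congr (fun x _ => by simp) |>.trans image_id).symm
    rw [h, hXeq, image_image]; exact image_congr fun v _ => by simp [Function.comp_apply]
  have hBi : B i = (({0, 1, ((y' : ℕ) : ZMod 61)} : Finset (ZMod 61))).image fun v => -(m' * v + x₀') := by
    have h : B i = ((B i).image fun x => (0 : ZMod 61) - x).image fun x => (0 : ZMod 61) - x := by
      rw [image_image]; exact (image_congr (fun x _ => by simp) |>.trans image_id).symm
    rw [h, hXBeq, image_image]; exact image_congr fun v _ => by simp [Function.comp_apply]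
  have hA3i : A3 i = ({0, 1, ((y₀ : ℕ) : ZMod 61)} : Finset (ZMod 61)).image fun w => -w := by
    rw [hA3eq, hti, hAi, image_image, ← hcls, image_image]
    refine image_congr fun v _ => ?_
    simp only [Function.comp_apply]
    rw [hg]; linear_combination (-v) * hlamm
  have hB3i : B3 i = ({0, 1, ((y₀' : ℕ) : ZMod 61)} : Finset (ZMod 61)).image fun w => -(uZ * w) := by
    rw [hB3eq, hti, hBi, image_image, ← hcls', image_image]
    refine image_congr fun v _ => ?_
    simp only [Function.comp_apply]
    rw [hβ, hg]; linear_combination v * huZμ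
  -- value lists of `A3 i`, `B3 i`
  have hy61 : y₀ < 61 := by omega
  have hy61' : 61 - y₀ < 61 := by omega
  have hy61'' : y₀' < 61 := by omega
  have hPmem : ∀ v, v ∈ c22P 61 y₀ ↔ ∃ x ∈ A3 i, x.val = v := by
    have hl : c22P 61 y₀ = [(-(0 : ZMod 61)).val, (-(1 : ZMod 61)).val, (-((y₀ : ℕ) : ZMod 61)).val] := by
      rw [c22P, neg_zero, ZMod.val_zero, zmod61_val_neg_one, val_neg_natCast, Nat.mod_eq_of_lt hy61, Nat.mod_eq_of_lt hy61']
    rw [hl, hA3i, image_insert, image_insert, image_singleton]; exact valSpec_three _ _ _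
  have hPnd : (c22P 61 y₀).Nodup := by
    rw [c22P]
    refine List.nodup_cons.2 ⟨?_, List.nodup_cons.2 ⟨?_, List.nodup_singleton _⟩⟩
    · simp only [List.mem_cons, List.not_mem_nil, or_false, not_or]; omega
    · simp only [List.mem_singleton]; omega
  have hQl : c22Q 61 u y₀' = [(-(uZ * 0)).val, (-(uZ * 1)).val, (-(uZ * ((y₀' : ℕ) : ZMod 61))).val] := by
    rw [c22Q, mul_zero, neg_zero, ZMod.val_zero, mul_one, ← hucast, val_neg_natCast, ← Nat.cast_mul, val_neg_natCast]
  have hQmem : ∀ v, v ∈ c22Q 61 u y₀' ↔ ∃ x ∈ B3 i, x.val = v := by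
    rw [hQl, hB3i, image_insert, image_insert, image_singleton]; exact valSpec_three _ _ _
  have hQnd : (c22Q 61 u y₀').Nodup := by
    have hy1 : ((y₀' : ℕ) : ZMod 61) ≠ 1 := fun h => by
      have := congrArg ZMod.val h; rw [ZMod.val_cast_of_lt hy61'', ZMod.val_one] at this; omega
    have hy0 : ((y₀' : ℕ) : ZMod 61) ≠ 0 := fun h => by
      have := congrArg ZMod.val h; rw [ZMod.val_cast_of_lt hy61'', ZMod.val_zero] at this; omega
    have hne1 : -(uZ * 0) ≠ -(uZ * 1) := by
      rw [mul_zero, mul_one, neg_zero]; exact fun h => huZ0 (neg_eq_zero.1 h.symm)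
    have hne2 : -(uZ * 0) ≠ -(uZ * ((y₀' : ℕ) : ZMod 61)) := by
      rw [mul_zero, neg_zero]; exact fun h => mul_ne_zero huZ0 hy0 (neg_eq_zero.1 h.symm)
    have hne3 : -(uZ * 1) ≠ -(uZ * ((y₀' : ℕ) : ZMod 61)) := by
      intro h; have := mul_left_cancel₀ huZ0 (neg_inj.1 h); exact hy1 (by rw [← this])
    have h3 : ([-(uZ * 0), -(uZ * 1), -(uZ * ((y₀' : ℕ) : ZMod 61))] : List (ZMod 61)).Nodup := by
      refine List.nodup_cons.2 ⟨?_, List.nodup_cons.2 ⟨?_, List.nodup_singleton _⟩⟩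
      · simp only [List.mem_cons, List.not_mem_nil, or_false, not_or]; exact ⟨hne1, hne2⟩
      · simp only [List.mem_singleton]; exact hne3
    rw [hQl]; exact h3.map (ZMod.val_injective 61)
  -- `SY3 = ⟦S⟧` and `T3 = uZ·⟦S'⟧ + σ`
  have hlt3 : ∀ x ∈ ([0, 1, y] : List ℕ), x < 61 := by
    intro x hx; simp only [List.mem_cons, List.not_mem_nil, or_false] at hx; omega
  have hlt3' : ∀ x ∈ ([0, 1, y'] : List ℕ), x < 61 := by
    intro x hx; simp only [List.mem_cons, List.not_mem_nil, or_false] at hx; omega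
  have hto : (([0, 1, y] : List ℕ).map fun x : ℕ => (x : ZMod 61)).toFinset = ({0, 1, ((y : ℕ) : ZMod 61)} : Finset (ZMod 61)) := by simp
  have hto' : (([0, 1, y'] : List ℕ).map fun x : ℕ => (x : ZMod 61)).toFinset = ({0, 1, ((y' : ℕ) : ZMod 61)} : Finset (ZMod 61)) := by simp
  set E := (({0, 1, ((y : ℕ) : ZMod 61)} : Finset (ZMod 61)) + setOfMask 61 Bm) with hE
  set E' := (({0, 1, ((y' : ℕ) : ZMod 61)} : Finset (ZMod 61)) + setOfMask 61 Bm') with hE'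
  have hSset : setOfMask 61 S = E.image fun v => μ * v + (c + t₀) := by
    rw [hSdef, setOfMask_normMask (affMask_lt _ _ _), setOfMask_affMask,
      setOfMask_sumMask hlt3 hBm, hto, image_image]
    exact image_congr fun v _ => by simp only [Function.comp_apply]; ring
  have hS'set : setOfMask 61 S' = E'.image fun v => μ' * v + (c' + t₀') := by
    rw [hS'def, setOfMask_normMask (affMask_lt _ _ _), setOfMask_affMask,
      setOfMask_sumMask hlt3' hBm', hto', image_image]
    exact image_congr fun v _ => by simp only [Function.comp_apply]; ring
  have hSYeq : (A i).image (fun x => (0 : ZMod 61) - x) + DU B C (univ.erase i) = E.image fun v => m * v + (x₀ + τA) := by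
    rw [hXeq, hYeq, image_add_image_affine]
  have hTeq : (B i).image (fun x => (0 : ZMod 61) - x) + DU A C (univ.erase i) = E'.image fun v => m' * v + (x₀' + τB) := by
    rw [hXBeq, hZeq, image_add_image_affine]
  have hDU3 : DU B3 C3 (univ.erase i) = (DU B C (univ.erase i)).image fun yy => lam * yy + (γ - β) :=
    DU_eq_image_affine lam (γ - β) (fun k => t k + β) (fun k => t k + γ) (fun k => by ring) hmemB3 hmemC3 _
  have hDU3' : DU A3 C3 (univ.erase i) = (DU A C (univ.erase i)).image fun yy => lam * yy + γ :=
    DU_eq_image_affine lam γ t (fun k => t k + γ) (fun k => by ring) hmemA3 hmemC3 _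
  have hSY3 : (A3 i).image (fun x => (0 : ZMod 61) - x) + DU B3 C3 (univ.erase i) =
      ((A i).image (fun x => (0 : ZMod 61) - x) + DU B C (univ.erase i)).image fun v => lam * v + δ := by
    have h := negImage_add_DU_eq_image_affine (A := A) (B := B) (C := C) (B' := B3) (C' := C3) (A'i := A3 i) i (univ.erase i)
      lam g (γ - β) (fun x => by rw [hmemA3, hti]) hDU3
    rw [h]; exact image_congr fun v _ => by rw [hγ]; ring
  have hT3 : (B3 i).image (fun x => (0 : ZMod 61) - x) + DU A3 C3 (univ.erase i) =
      ((B i).image (fun x => (0 : ZMod 61) - x) + DU A C (univ.erase i)).image fun v => lam * v + δ := by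
    have h := negImage_add_DU_eq_image_affine (A := B) (B := A) (C := C) (B' := A3) (C' := C3) (A'i := B3 i) i (univ.erase i)
      lam (g + β) γ (fun x => by rw [hmemB3, hti]) hDU3'
    rw [h]; exact image_congr fun v _ => by rw [hγ]; ring
  have hSY3set : (A3 i).image (fun x => (0 : ZMod 61) - x) + DU B3 C3 (univ.erase i) = setOfMask 61 S := by
    rw [hSY3, hSYeq, hSset, image_image]
    exact image_congr fun v _ => by simp only [Function.comp_apply]; rw [hδ]; linear_combination v * hlamm
  set Tm := rot 61 (dilRunsMask 61 u (runsOf 61 S')) s with hTm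
  have hTm_lt : Tm < 2 ^ 61 := rot_lt_two_pow 61 _ _
  have hT3set : (B3 i).image (fun x => (0 : ZMod 61) - x) + DU A3 C3 (univ.erase i) = setOfMask 61 Tm := by
    rw [hT3, hTeq, hTm, setOfMask_rot (dilRunsMask_lt (by norm_num) _) hs61.le, setOfMask_dilRunsMask, hS'rt, hS'set, image_image,
      image_image, image_image, hucast, hscast]
    exact image_congr fun v _ => by simp only [Function.comp_apply]; rw [hσ]; linear_combination (-v) * huZμ
  have hSYspec : ∀ v, tb S v = true ↔ ∃ e ∈ (A3 i).image (fun x => (0 : ZMod 61) - x) + DU B3 C3 (univ.erase i), e.val = v := by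
    intro v; rw [hSY3set]; exact tb_iff_setOfMask hSlt v
  have hTspec : ∀ v, tb Tm v = true ↔ ∃ e ∈ (B3 i).image (fun x => (0 : ZMod 61) - x) + DU A3 C3 (univ.erase i), e.val = v := by
    intro v; rw [hT3set]; exact tb_iff_setOfMask hTm_lt v
  -- the exact partition
  have hW3 : #(((A3 i) ×ˢ ((B3 i) ×ˢ (C3 i))).image fun q : ZMod 61 × ZMod 61 × ZMod 61 => (0 : ZMod 61) + q.2.2 - q.1 - q.2.1) = 27 := by
    rw [card_image_blockSum hS3' i 0, hcardA, hcardB, hcardC, ha, hb, hc]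
  have hSY3card : #((A3 i).image (fun x => (0 : ZMod 61) - x) + DU B3 C3 (univ.erase i)) = 17 := by
    rw [hSY3, card_image_of_injective _ (affine_injective' hlam0 _), hSY]
  have hT3card : #((B3 i).image (fun x => (0 : ZMod 61) - x) + DU A3 C3 (univ.erase i)) = 17 := by
    rw [hT3, card_image_of_injective _ (affine_injective' hlam0 _), hT]
  have hpart := union_eq_univ_of_card hS3' i (by rw [hW3, hSY3card, hT3card, ZMod.card])
  -- the rows kill the normal form
  have hu : u ∈ List.range' 1 60 := by rw [List.mem_range'_1]; omega
  have he : (dilRunsMask 61 u (runsOf 61 S'), runsOf 61 S') ∈ c22TShapes 61 u (c22Sh y₀') :=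
    List.mem_map.2 ⟨S', hS'mem, rfl⟩
  exact c22_false_of_normal_form hS3' hA3ne hB3ne hC3ne i hc3 hz3 hL3 (c22P 61 y₀) (c22Q 61 u y₀') hPmem hPnd hQmem hQnd hSYspec hTspec
    hpart hs61 hTm hS'runs he ks hks hksi hszs3 hdead (hrows u hu y₀ hy₀ y₀' hy₀' S hSmem)


end Summit.MatrixMultiplication.OmegaCensus.CubeNB.S2
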